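import Summits.QuantumFields.BalabanUV.T4Continuum.Support.NE7PushDirNearFlat
import Summits.QuantumFields.BalabanUV.T4Continuum.Support.NE7FlatAverageCurlCommutation
import Summits.QuantumFields.BalabanUV.T4Continuum.Support.NE3CpushGaugeCovariance
import Summits.QuantumFields.BalabanUV.T4Continuum.Support.NE3CovLiftCurl
import Summits.QuantumFields.BalabanUV.T4Continuum.Support.NE3AxialGaugeLadder
import Summits.QuantumFields.BalabanUV.T4Continuum.Support.BlockAverageCurrentNearId
import HarnessLib

/-!
# NE7CurvedAverageCurlLetter — BAŁABAN'S (48) AT A SMALL-FIELD BACKGROUND, WITH REMAINDER: THE DRESSED CURL OF THE LINEARISED AVERAGE IS THE BLOCK AVERAGE OF THE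
# TRANSPORTED FINE CURLS UP TO `O(a)·ℓ¹` — `‖curl_{V̄}(T_W ψ)(z;μ,ν) − Σ_x L^{−d}·Σ_{i,j<L} Ad_{W(Γ_{Lz,p})} curl_W ψ(p;μ,ν)‖ ≤ C(d,L)·a·‖ψ‖_{ℓ¹(box)}`
# (lineage `b2b-balaban-t4-ne7-p1`, gen 117, file F2; ROAD-G116 §7∕§9 (G1) «the curved commutation letter»)

Cell `pub-balaban`, rung (B)+1 sub-cell t4, CRUX PROVER NE7 #1 (OWNER of row NE7), generation 117.  Gen 116's ✓ `NE7FlatAverageCurlCommutation` is the FLAT case (an identity,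
[Balaban1985Averaging] (48) p. 25: corner cancellation + abelian Stokes); at a curved `U(N)` background `W` in the standard small-field class (`SmallField W a`,
`512(d+1)(d+4)L²a ≤ 1`) the identity survives as an ESTIMATE whose remainder is ZERO ORDER in `ψ` and FIRST ORDER in the plaquette radius `a`:

  `curlAt (cavg L W) (cpush L W ψ) z μ ν = Σ_{r} L^{−d} • Σ_{i,j<L} Ad_{W(Γ_{Lz, p(r,i,j)})} (curlAt W ψ p(r,i,j) μ ν) + E`,  `‖E‖ ≤ curlLetterC(d,L)·a·dirL1 ψ (box ((2d+4)L) (L•z))`,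

`p(r,i,j) = L•z + x_r + i e_μ + j e_ν`, `Γ_{Lz,p}` the tree word from the block corner (the transports are isometries of every unitarily invariant norm, so the energy
inequality of F3 sees only `Σ nhsNormSq(curl_W ψ p)`).
METHOD ([folklore]): §1 a NEAR-IDENTITY letter (links within `b` of `1` near the block, no gauge condition): the four pieces `curl_{V̄} − curl_1` of the coarse field
(✓ `NE3CovLiftCurl.norm_curlAt_sub_flat_le`, coarse links within `L·b + 4·loopRad` by ✓ `NE3NestedBlockMeanCovariance.norm_cavg_sub_one_le`, coarse field `≤ 32(2d+3)L·ℓ¹` by F1),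
`curl_1 (T_W ψ − T_1 ψ)` (F1 ✓ `NE7PushDirNearFlat.norm_pushDir_sub_Tside_le_box`), the flat identity (✓ `BlockAverageCurrentAbelian.coarseFlux_eq_avg_stokes`), and
`curl_1 ψ − curl_W ψ` on the `L^{d+2}` fine plaquettes; §2 the AXIAL GAUGE based at `L•z` (tree `B7Prop1Explicit.axial_bond_bound`: links within `|x − Lz|₁·a` of `1`) and the exact
covariance of every object (✓ `cavg_gaugeAct`, ✓ `cpush_gaugeAct`, ✓ `curlAt_gaugeAct`; `ℓ¹` norms are gauge invariant) carry §1 to every small-field background — the gauge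
function at the fine plaquette corners is the displayed transport `W(Γ_{Lz,p})`.
HONEST FRAMING: lattice kinematics of ONE averaging step; constants polynomial in `d, L`, not optimised; nothing of Bałaban's asserted ((48) p. 25 context only); NOT (G′), NOT NE7 as a
spine node, NOT NE3; spine 0∕9; finite T⁴ rung (B)+1 — NOT infinite volume, NOT mass gap, NOT BetaPertH, NOT Clay.
-/

set_option autoImplicit false

open scoped BigOperators Matrix.Norms.L2Operator
open NormedSpace Finset

namespace Summit.QuantumFields.BalabanUV.T4Continuum.NE7CurvedAverageCurlLetter

open Literature.MathematicalPhysics.QuantumFieldTheory.Balaban1983to89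
open B7Prop1Explicit B7Prop2Explicit MatrixLog UnitaryModel
open T4AveragingDeficitWall (IsUnitaryCfg SmallField Ad curlAt dirL1 box)
open AveragingDeficitTransport (norm_Ad_of_unitary mem_U1_of_unitary)
open AveragingDeficitNearIdentity (Ad_one)
open AveragingDeficitLocality (dirGauge)
open AveragingDeficitCounting (box_mono box_subset_box_of_mem mem_box_iff)
open AveragingDeficitPlaqLin (mem_box_of_l1)
open AveragingDeficitDerivCore (dirL1_nonneg)
open AveragingDeficitChartCalculus (cavg)
open AveragingDeficitMultiLevelPrep (cpush)
open AveragingDeficitResidualPairing (pushDir)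
open BlockAveragePushDirSplit (flat sum_blockWeight_eq_one)
open BlockAverageCurrentAbelian (coarseFlux_eq_avg_stokes)
open BlockAverageCurrentNearId (l1_Lstep)
open SpreadLift (loopRad loopRad_le)
open NE3NestedBlockMeanCovariance (cavg_gaugeAct norm_cavg_sub_one_le)
open NE3CpushGaugeCovariance (cpush_gaugeAct)
open NE3CovLiftCurl (curlAt_gaugeAct norm_curlAt_sub_flat_le)
open NE3AxialGaugeLadder (smallField_gaugeAct)
open NE7FlatAverageCurlCommutation (curlAt_flatCfg curlAt_flatCfg_eq_asum)
open NE7PushDirNearFlat (norm_pushDir_sub_Tside_le_box norm_pushDir_le_box)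
open MinimalActionWitness (flatCfg)

noncomputable section

variable {d : ℕ} {n : Type*} [Fintype n] [DecidableEq n]

/-! ## §0 Bookkeeping: boxes, `ℓ¹` monotonicity, the loop radius -/

/-- `dirL1` is monotone in the region. [folklore] -/
theorem dirL1_mono (ψ : Site d → Fin d → Matrix n n ℂ) {A B : Finset (Site d)} (h : A ⊆ B) : dirL1 ψ A ≤ dirL1 ψ B :=
  Finset.sum_le_sum_of_subset_of_nonneg h fun _ _ _ => Finset.sum_nonneg fun _ _ => norm_nonneg _

/-- A single field value is below the `ℓ¹` norm of any box containing its site. [folklore] -/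
theorem norm_le_dirL1_of_mem (ψ : Site d → Fin d → Matrix n n ℂ) {B : Finset (Site d)} {x : Site d} (hx : x ∈ B) (κ : Fin d) : ‖ψ x κ‖ ≤ dirL1 ψ B := by
  unfold T4AveragingDeficitWall.dirL1
  exact (Finset.single_le_sum (f := fun κ => ‖ψ x κ‖) (fun _ _ => norm_nonneg _) (Finset.mem_univ κ)).trans
    (Finset.single_le_sum (f := fun y => ∑ κ : Fin d, ‖ψ y κ‖) (fun _ _ => Finset.sum_nonneg fun _ _ => norm_nonneg _) hx)

/-- `l1 (x_r + i e_μ + j e_ν) ≤ dL + i + j`. [folklore] -/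
theorem l1_offset_le (L : ℕ) (r : Fin d → Fin L) (i j : ℕ) (μ ν : Fin d) :
    l1 (boxVec L r + (i : ℤ) • (e μ : Site d) + (j : ℤ) • e ν) ≤ d * L + i + j := by
  have h1 := l1_add_le (boxVec L r + (i : ℤ) • (e μ : Site d)) ((j : ℤ) • e ν)
  have h2 := l1_add_le (boxVec L r) ((i : ℤ) • (e μ : Site d))
  have h3 := l1_boxVec_le L r
  have h4 : l1 ((i : ℤ) • (e μ : Site d)) = i := l1_Lstep i μ
  have h5 : l1 ((j : ℤ) • (e ν : Site d)) = j := l1_Lstep j ν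
  omega

/-! ## §1 The near-identity letter (links within `b` of `1` near the block; no gauge condition) -/

/-- THE CONSTANT of the near-identity letter at link radius `b` and loop radius `ρ`:
`16·(L b + 4ρ)·32·((2d+2)L + L) + 4·(64(L b + 4ρ) + 1250ρ + 2(2d+2)L·b)·((2d+2)L + L) + 16L²·b`. [folklore] -/
def nearIdC (d L : ℕ) (b ρ : ℝ) : ℝ :=
  16 * ((L : ℝ) * b + 4 * ρ) * (32 * ((((2 * d + 2) * L : ℕ) : ℝ) + L))
    + 4 * (64 * ((L : ℝ) * b + 4 * ρ) + 1250 * ρ + 2 * ((2 * (d : ℝ) + 2) * L) * b) * ((((2 * d + 2) * L : ℕ) : ℝ) + L)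
    + 16 * (L : ℝ) ^ 2 * b

/-- **THE NEAR-IDENTITY LETTER**: for `U(N)` data `W` in the standard small-field class whose links starting within `ℓ¹`-distance `(2d+4)L` of the block corner `L•z` are within
`b` of `1`, and every direction field `ψ`,
`‖curlAt (cavg L W) (cpush L W ψ) z μ ν − Σ_r L^{−d} • Σ_{i,j<L} curlAt W ψ (L•z + x_r + i e_μ + j e_ν) μ ν‖ ≤ nearIdC d L b (loopRad d L a) · dirL1 ψ (box ((2d+4)L) (L•z))`.
[cite: Balaban1985Averaging, (48) p.25] -/
theorem norm_curlAt_cavg_cpush_sub_avg_le_of_links [Nonempty n] {L : ℕ} (hL : 1 ≤ L) {W : Site d → Fin d → (Matrix n n ℂ)ˣ} (hW : IsUnitaryCfg W)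
    {a : ℝ} (ha : 0 ≤ a) (h512 : 512 * (d + 1) * (d + 4) * (L : ℝ) ^ 2 * a ≤ 1) (hWa : SmallField W a)
    (z : Site d) {b : ℝ} (hb : 0 ≤ b)
    (hWb : ∀ (x : Site d) (μ' : Fin d), l1 (x - (L : ℤ) • z) ≤ (2 * d + 4) * L → ‖((W x μ' : (Matrix n n ℂ)ˣ) : Matrix n n ℂ) - 1‖ ≤ b)
    (ψ : Site d → Fin d → Matrix n n ℂ) (μ ν : Fin d) :
    ‖curlAt (cavg L W) (cpush L W ψ) z μ ν
        - ∑ r : Fin d → Fin L, (((L : ℝ) ^ d)⁻¹ : ℝ) • ∑ i ∈ Finset.range L, ∑ j ∈ Finset.range L,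
            curlAt W ψ ((L : ℤ) • z + boxVec L r + (i : ℤ) • e μ + (j : ℤ) • e ν) μ ν‖
      ≤ nearIdC d L b (loopRad d L a) * dirL1 ψ (box ((2 * d + 4) * L) ((L : ℤ) • z)) := by
  have hL0 : (0 : ℤ) ≤ L := by exact_mod_cast (Nat.zero_le L)
  have hLr : (1 : ℝ) ≤ L := by exact_mod_cast hL
  set y : Site d := (L : ℤ) • z with hy
  set ρ : ℝ := loopRad d L a with hρ
  have hρ0 : 0 ≤ ρ := by rw [hρ]; unfold SpreadLift.loopRad; positivity
  have hρ32 : ρ ≤ 1 / 32 := loopRad_le h512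
  set D : ℝ := dirL1 ψ (box ((2 * d + 4) * L) y) with hD
  have hD0 : 0 ≤ D := dirL1_nonneg ψ _
  set Φ : Site d → Fin d → Matrix n n ℂ := cpush L W ψ with hΦ
  set Vb : Site d → Fin d → (Matrix n n ℂ)ˣ := cavg L W with hVb
  have hU1 : ∀ x κ, W x κ ∈ U1 (Matrix n n ℂ) := fun x κ => mem_U1_of_unitary (hW x κ)
  -- loop variables everywhere
  have hloop : ∀ (q : Site d) (κ : Fin d) (r : Fin d → Fin L), ‖((Wcx L W q κ (boxVec L r) : (Matrix n n ℂ)ˣ) : Matrix n n ℂ) - 1‖ ≤ ρ :=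
    fun q κ r => norm_Wcx_sub_one_le L hL W hU1 ha h512 hWa q κ r
  -- the box [y, y + 2L·𝟙] for the coarse links
  set hi : Site d := y + fun _ => (2 * L : ℤ) with hhi
  have hbox : ∀ (x : Site d) (ν' : Fin d), y ≤ x → x + e ν' ≤ hi → ‖((W x ν' : (Matrix n n ℂ)ˣ) : Matrix n n ℂ) - 1‖ ≤ b := by
    intro x ν' hx hx'
    refine hWb x ν' ?_
    have hle : ∀ ι, 0 ≤ (x - y) ι ∧ (x - y) ι ≤ 2 * L := fun ι => by
      have h1 : y ι ≤ x ι := hx ι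
      have h2 : (x + e ν') ι ≤ hi ι := hx' ι
      have h3 : (0 : ℤ) ≤ (e ν' : Site d) ι := by simp only [e, Pi.single_apply]; split_ifs <;> norm_num
      simp only [hhi, Pi.add_apply, Pi.sub_apply] at h2 ⊢
      constructor <;> omega
    unfold l1
    calc ∑ ι, ((x - y) ι).natAbs ≤ ∑ _ι : Fin d, 2 * L := Finset.sum_le_sum fun ι _ => by have := hle ι; omega
      _ = d * (2 * L) := by simp
      _ ≤ (2 * d + 4) * L := by nlinarith
  -- the coarse links at the three transporting bonds are within `β̄ := L b + 4ρ` of `1`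
  set β : ℝ := (L : ℝ) * b + 4 * ρ with hβ
  have hβ0 : 0 ≤ β := by positivity
  have hcoarse : ∀ (z' : Site d) (κ : Fin d), y ≤ (L : ℤ) • z' → (L : ℤ) • (z' + e κ) ≤ hi →
      ‖((Vb z' κ : (Matrix n n ℂ)ˣ) : Matrix n n ℂ) - 1‖ ≤ β := fun z' κ h1 h2 =>
    norm_cavg_sub_one_le hL hW ha h512 hWa hbox h1 h2
  have hez : ∀ (κ : Fin d) (ι : Fin d), (0 : ℤ) ≤ (e κ : Site d) ι ∧ (e κ : Site d) ι ≤ 1 := fun κ ι => by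
    simp only [e, Pi.single_apply]; split_ifs <;> norm_num
  have hsm : ∀ (v w : Site d), v ≤ w → (L : ℤ) • v ≤ (L : ℤ) • w := fun v w h ι => by
    simp only [Pi.smul_apply, smul_eq_mul]; exact mul_le_mul_of_nonneg_left (h ι) hL0
  have hze : ∀ (v : Site d) (κ : Fin d), v ≤ v + e κ := fun v κ ι => by
    simp only [Pi.add_apply]; linarith [(hez κ ι).1]
  have hhi_le : ∀ κ κ' : Fin d, (L : ℤ) • (z + e κ + e κ') ≤ hi := fun κ κ' ι => by
    simp only [hhi, hy, Pi.smul_apply, Pi.add_apply, smul_eq_mul]; nlinarith [(hez κ ι).2, (hez κ' ι).2, (hez κ ι).1, (hez κ' ι).1]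
  have hy_le : ∀ κ : Fin d, y ≤ (L : ℤ) • (z + e κ) := fun κ => hsm _ _ (hze z κ)
  have hzκ_le : ∀ κ κ' : Fin d, (L : ℤ) • (z + e κ + e κ') ≤ hi → (L : ℤ) • (z + e κ) ≤ hi := fun κ κ' h => (hsm _ _ (hze _ κ')).trans h
  have hV1 : ‖((Vb z μ : (Matrix n n ℂ)ˣ) : Matrix n n ℂ) - 1‖ ≤ β := hcoarse z μ le_rfl (hzκ_le μ μ (hhi_le μ μ))
  have hV2 : ‖((Vb (z + e μ) ν : (Matrix n n ℂ)ˣ) : Matrix n n ℂ) - 1‖ ≤ β := hcoarse (z + e μ) ν (hy_le μ) (hhi_le μ ν)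
  have hV3 : ‖((Vb (z + e ν) μ : (Matrix n n ℂ)ˣ) : Matrix n n ℂ) - 1‖ ≤ β := hcoarse (z + e ν) μ (hy_le ν) (hhi_le ν μ)
  have hV4 : ‖((Vb z ν : (Matrix n n ℂ)ˣ) : Matrix n n ℂ) - 1‖ ≤ β := hcoarse z ν le_rfl (hzκ_le ν ν (hhi_le ν ν))
  -- F1 at the four coarse bonds: the boxes `box ((2d+2)L) q` sit inside `box ((2d+4)L) y`
  have hsub : ∀ q : Site d, l1 (q - y) ≤ L → box ((2 * d + 2) * L) q ⊆ box ((2 * d + 4) * L) y := by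
    intro q hq
    have hmem : q ∈ box L y := mem_box_of_l1 hq
    refine (box_subset_box_of_mem (R₂ := (2 * d + 2) * L) hmem).trans (box_mono (by nlinarith) y)
  have hq0 : l1 (y - y) ≤ L := by simp [l1]
  have hqκ : ∀ κ : Fin d, l1 ((L : ℤ) • (z + e κ) - y) ≤ L := fun κ => by
    rw [hy, smul_add, add_sub_cancel_left, l1_Lstep]
  -- links near each `q` (ℓ¹-distance (2d+2)L of q, q within L of y ⇒ within (2d+3)L ≤ (2d+4)L of y)
  have hlinks : ∀ q : Site d, l1 (q - y) ≤ L → ∀ (x : Site d) (μ' : Fin d), l1 (x - q) ≤ (2 * d + 2) * L →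
      ‖((W x μ' : (Matrix n n ℂ)ˣ) : Matrix n n ℂ) - 1‖ ≤ b := by
    intro q hq x μ' hx
    refine hWb x μ' ?_
    have h := l1_add_le (x - q) (q - y)
    rw [show x - q + (q - y) = x - y by abel] at h
    nlinarith
  -- size of the coarse field and its distance to `T_c`, at a coarse bond `(z', κ)` with `L•z'` within `L` of `y`
  set Q : ℝ := (((2 * d + 2) * L : ℕ) : ℝ) + L with hQ
  have hQ0 : 0 ≤ Q := by positivity
  have hΦle : ∀ (z' : Site d) (κ : Fin d), l1 ((L : ℤ) • z' - y) ≤ L → ‖Φ z' κ‖ ≤ 32 * Q * D := by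
    intro z' κ hz'
    have h := norm_pushDir_le_box hL hW ψ ((L : ℤ) • z') κ hρ32 (hloop _ κ)
    refine h.trans ?_
    rw [mul_assoc]
    exact mul_le_mul_of_nonneg_left (mul_le_mul_of_nonneg_left (dirL1_mono ψ (hsub _ hz')) hQ0) (by norm_num)
  have hΦT : ∀ (z' : Site d) (κ : Fin d), l1 ((L : ℤ) • z' - y) ≤ L → ‖((Vb z' κ : (Matrix n n ℂ)ˣ) : Matrix n n ℂ) - 1‖ ≤ β →
      ‖Φ z' κ - Tside L ψ ((L : ℤ) • z') κ‖ ≤ (64 * β + 1250 * ρ + 2 * ((2 * d + 2) * L) * b) * (Q * D) := by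
    intro z' κ hz' hVz
    have h := norm_pushDir_sub_Tside_le_box hL hW ψ ((L : ℤ) • z') κ hb hρ32 (hloop _ κ) (hlinks _ hz') hVz
    refine h.trans (mul_le_mul_of_nonneg_left (mul_le_mul_of_nonneg_left (dirL1_mono ψ (hsub _ hz')) hQ0) ?_)
    positivity
  -- Term A: `curl_{V̄} Φ − curl_1 Φ`
  have hz0 : l1 ((L : ℤ) • z - y) ≤ L := by rw [hy]; simp [l1]
  have hA : ‖curlAt Vb Φ z μ ν - curlAt (flat (d := d) (n := n)) Φ z μ ν‖ ≤ 16 * β * (32 * Q * D) := by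
    have hVu : IsUnitaryCfg Vb := AveragingDeficitTwoLevelPrep.cavg_isUnitaryCfg hL hW ha h512 hWa
    exact norm_curlAt_sub_flat_le hVu Φ z μ ν hβ0 hV1 hV2 hV3 (hΦle z μ hz0) (hΦle _ ν (hqκ μ)) (hΦle _ μ (hqκ ν)) (hΦle z ν hz0)
  -- Term B: `curl_1 (Φ − T)`
  set T : Site d → Fin d → Matrix n n ℂ := fun z' κ => Tside L ψ ((L : ℤ) • z') κ with hT
  have hB : ‖curlAt (flat (d := d) (n := n)) Φ z μ ν - curlAt (flat (d := d) (n := n)) T z μ ν‖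
      ≤ 4 * ((64 * β + 1250 * ρ + 2 * ((2 * d + 2) * L) * b) * (Q * D)) := by
    have hff : (flat (d := d) (n := n)) = (flatCfg : Site d → Fin d → (Matrix n n ℂ)ˣ) := rfl
    rw [hff, curlAt_flatCfg, curlAt_flatCfg]
    have e1 : Φ z μ + Φ (z + e μ) ν - Φ (z + e ν) μ - Φ z ν - (T z μ + T (z + e μ) ν - T (z + e ν) μ - T z ν)
        = (Φ z μ - T z μ) + (Φ (z + e μ) ν - T (z + e μ) ν) - (Φ (z + e ν) μ - T (z + e ν) μ) - (Φ z ν - T z ν) := by abel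
    rw [e1]
    have h1 := hΦT z μ hz0 hV1
    have h2 := hΦT (z + e μ) ν (hqκ μ) hV2
    have h3 := hΦT (z + e ν) μ (hqκ ν) hV3
    have h4 := hΦT z ν hz0 hV4
    calc _ ≤ ‖Φ z μ - T z μ‖ + ‖Φ (z + e μ) ν - T (z + e μ) ν‖ + ‖Φ (z + e ν) μ - T (z + e ν) μ‖ + ‖Φ z ν - T z ν‖ := by
            refine (norm_sub_le _ _).trans (add_le_add ((norm_sub_le _ _).trans (add_le_add (norm_add_le _ _) le_rfl)) le_rfl)
      _ ≤ _ := by simp only [hT] at h1 h2 h3 h4 ⊢; linarith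
  -- Term C: the flat identity (48)
  have hC : curlAt (flat (d := d) (n := n)) T z μ ν
      = ∑ r : Fin d → Fin L, (((L : ℝ) ^ d)⁻¹ : ℝ) • ∑ i ∈ Finset.range L, ∑ j ∈ Finset.range L,
          curlAt (flat (d := d) (n := n)) ψ (y + boxVec L r + (i : ℤ) • e μ + (j : ℤ) • e ν) μ ν := by
    have hff : (flat (d := d) (n := n)) = (flatCfg : Site d → Fin d → (Matrix n n ℂ)ˣ) := rfl
    rw [hff, curlAt_flatCfg]
    simp only [hT, smul_add, hy, curlAt_flatCfg_eq_asum]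
    exact coarseFlux_eq_avg_stokes L ψ ((L : ℤ) • z) μ ν
  -- Term D: `curl_1 ψ − curl_W ψ` on the fine plaquettes
  have hfine : ∀ (r : Fin d → Fin L) (i j : ℕ), i < L → j < L →
      ‖curlAt W ψ (y + boxVec L r + (i : ℤ) • e μ + (j : ℤ) • e ν) μ ν - curlAt (flat (d := d) (n := n)) ψ (y + boxVec L r + (i : ℤ) • e μ + (j : ℤ) • e ν) μ ν‖
        ≤ 16 * b * D := by
    intro r i j hi hj
    set p : Site d := y + boxVec L r + (i : ℤ) • e μ + (j : ℤ) • e ν with hp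
    have hpy : l1 (p - y) ≤ d * L + i + j := by
      rw [hp, show y + boxVec L r + (i : ℤ) • e μ + (j : ℤ) • e ν - y = boxVec L r + (i : ℤ) • e μ + (j : ℤ) • e ν by abel]
      exact l1_offset_le L r i j μ ν
    have hR : d * L + i + j + 1 ≤ (2 * d + 4) * L := by nlinarith
    have hlink : ∀ (x : Site d) (κ : Fin d), l1 (x - p) ≤ 1 → ‖((W x κ : (Matrix n n ℂ)ˣ) : Matrix n n ℂ) - 1‖ ≤ b := by
      intro x κ hx
      refine hWb x κ ?_
      have h := l1_add_le (x - p) (p - y)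
      rw [show x - p + (p - y) = x - y by abel] at h
      omega
    have hmem : ∀ x : Site d, l1 (x - p) ≤ 1 → x ∈ box ((2 * d + 4) * L) y := fun x hx => by
      refine mem_box_of_l1 ?_
      have h := l1_add_le (x - p) (p - y)
      rw [show x - p + (p - y) = x - y by abel] at h
      omega
    have hp0 : l1 (p - p) ≤ 1 := by simp [l1]
    have hpe : ∀ κ : Fin d, l1 (p + e κ - p) ≤ 1 := fun κ => by
      rw [add_sub_cancel_left]; have := l1_Lstep (d := d) 1 κ; simp only [Nat.cast_one, one_smul] at this; exact this.le
    exact norm_curlAt_sub_flat_le hW ψ p μ ν hb (hlink p μ hp0) (hlink _ ν (hpe μ)) (hlink _ μ (hpe ν))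
      (norm_le_dirL1_of_mem ψ (hmem p hp0) μ) (norm_le_dirL1_of_mem ψ (hmem _ (hpe μ)) ν) (norm_le_dirL1_of_mem ψ (hmem _ (hpe ν)) μ)
      (norm_le_dirL1_of_mem ψ (hmem p hp0) ν)
  have hDterm : ‖(∑ r : Fin d → Fin L, (((L : ℝ) ^ d)⁻¹ : ℝ) • ∑ i ∈ Finset.range L, ∑ j ∈ Finset.range L,
          curlAt (flat (d := d) (n := n)) ψ (y + boxVec L r + (i : ℤ) • e μ + (j : ℤ) • e ν) μ ν)
        - ∑ r : Fin d → Fin L, (((L : ℝ) ^ d)⁻¹ : ℝ) • ∑ i ∈ Finset.range L, ∑ j ∈ Finset.range L,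
          curlAt W ψ (y + boxVec L r + (i : ℤ) • e μ + (j : ℤ) • e ν) μ ν‖ ≤ 16 * (L : ℝ) ^ 2 * b * D := by
    rw [← Finset.sum_sub_distrib]
    simp only [← smul_sub, ← Finset.sum_sub_distrib]
    have h := norm_avg_le L hL (fun r : Fin d → Fin L => ∑ i ∈ Finset.range L, ∑ j ∈ Finset.range L,
        (curlAt (flat (d := d) (n := n)) ψ (y + boxVec L r + (i : ℤ) • e μ + (j : ℤ) • e ν) μ ν
          - curlAt W ψ (y + boxVec L r + (i : ℤ) • e μ + (j : ℤ) • e ν) μ ν)) (K := (L : ℝ) * ((L : ℝ) * (16 * b * D))) ?_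
    · refine h.trans (le_of_eq (by ring))
    intro r
    refine (norm_sum_le _ _).trans ?_
    calc ∑ i ∈ Finset.range L, ‖∑ j ∈ Finset.range L, (curlAt (flat (d := d) (n := n)) ψ (y + boxVec L r + (i : ℤ) • e μ + (j : ℤ) • e ν) μ ν
            - curlAt W ψ (y + boxVec L r + (i : ℤ) • e μ + (j : ℤ) • e ν) μ ν)‖
        ≤ ∑ i ∈ Finset.range L, ∑ j ∈ Finset.range L, 16 * b * D := by
          refine Finset.sum_le_sum fun i hi => (norm_sum_le _ _).trans (Finset.sum_le_sum fun j hj => ?_)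
          rw [norm_sub_rev]
          exact hfine r i j (Finset.mem_range.mp hi) (Finset.mem_range.mp hj)
      _ = (L : ℝ) * ((L : ℝ) * (16 * b * D)) := by simp only [Finset.sum_const, Finset.card_range, nsmul_eq_mul]
  -- assemble
  have e1 : curlAt Vb Φ z μ ν - ∑ r : Fin d → Fin L, (((L : ℝ) ^ d)⁻¹ : ℝ) • ∑ i ∈ Finset.range L, ∑ j ∈ Finset.range L,
          curlAt W ψ (y + boxVec L r + (i : ℤ) • e μ + (j : ℤ) • e ν) μ ν
      = (curlAt Vb Φ z μ ν - curlAt (flat (d := d) (n := n)) Φ z μ ν)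
        + (curlAt (flat (d := d) (n := n)) Φ z μ ν - curlAt (flat (d := d) (n := n)) T z μ ν)
        + ((∑ r : Fin d → Fin L, (((L : ℝ) ^ d)⁻¹ : ℝ) • ∑ i ∈ Finset.range L, ∑ j ∈ Finset.range L,
            curlAt (flat (d := d) (n := n)) ψ (y + boxVec L r + (i : ℤ) • e μ + (j : ℤ) • e ν) μ ν)
          - ∑ r : Fin d → Fin L, (((L : ℝ) ^ d)⁻¹ : ℝ) • ∑ i ∈ Finset.range L, ∑ j ∈ Finset.range L,
            curlAt W ψ (y + boxVec L r + (i : ℤ) • e μ + (j : ℤ) • e ν) μ ν) := by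
    rw [← hC]; abel
  rw [e1]
  calc _ ≤ ‖curlAt Vb Φ z μ ν - curlAt (flat (d := d) (n := n)) Φ z μ ν‖
          + ‖curlAt (flat (d := d) (n := n)) Φ z μ ν - curlAt (flat (d := d) (n := n)) T z μ ν‖
          + ‖(∑ r : Fin d → Fin L, (((L : ℝ) ^ d)⁻¹ : ℝ) • ∑ i ∈ Finset.range L, ∑ j ∈ Finset.range L,
              curlAt (flat (d := d) (n := n)) ψ (y + boxVec L r + (i : ℤ) • e μ + (j : ℤ) • e ν) μ ν)
            - ∑ r : Fin d → Fin L, (((L : ℝ) ^ d)⁻¹ : ℝ) • ∑ i ∈ Finset.range L, ∑ j ∈ Finset.range L,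
              curlAt W ψ (y + boxVec L r + (i : ℤ) • e μ + (j : ℤ) • e ν) μ ν‖ := norm_add₃_le
    _ ≤ 16 * β * (32 * Q * D) + 4 * ((64 * β + 1250 * ρ + 2 * ((2 * d + 2) * L) * b) * (Q * D)) + 16 * (L : ℝ) ^ 2 * b * D :=
        add_le_add (add_le_add hA hB) hDterm
    _ = nearIdC d L b ρ * D := by simp only [nearIdC, hβ, hQ]; push_cast; ring

/-! ## §2 Every small-field background: the axial gauge on the block neighbourhood and covariance -/

/-- THE CONSTANT of the curved letter: `curlLetterC d L = nearIdC d L ((2d+4)L) (16(d+1)(d+4)L²)` (link radius `(2d+4)L·a` in the axial gauge, loop radius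
`loopRad d L a = 16(d+1)(d+4)L²·a`), so that `nearIdC d L ((2d+4)L·a) (loopRad d L a) = curlLetterC d L · a`. [folklore] -/
def curlLetterC (d L : ℕ) : ℝ := nearIdC d L (((2 * d + 4) * L : ℕ) : ℝ) (16 * ((d : ℝ) + 1) * ((d : ℝ) + 4) * (L : ℝ) ^ 2)

omit [Fintype n] [DecidableEq n] in
/-- `nearIdC` is jointly homogeneous of degree one in `(b, ρ)`: `nearIdC d L (t b) (t ρ) = t · nearIdC d L b ρ`. [folklore] -/
theorem nearIdC_smul (d L : ℕ) (t b ρ : ℝ) : nearIdC d L (t * b) (t * ρ) = t * nearIdC d L b ρ := by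
  unfold nearIdC; ring

omit [Fintype n] [DecidableEq n] in
/-- `nearIdC d L ((2d+4)L·a) (loopRad d L a) = curlLetterC d L · a`. [folklore] -/
theorem nearIdC_axial_eq (d L : ℕ) (a : ℝ) :
    nearIdC d L ((((2 * d + 4) * L : ℕ) : ℝ) * a) (loopRad d L a) = curlLetterC d L * a := by
  have h : loopRad d L a = (16 * ((d : ℝ) + 1) * ((d : ℝ) + 4) * (L : ℝ) ^ 2) * a := by unfold SpreadLift.loopRad; ring
  rw [h, mul_comm (((((2 * d + 4) * L : ℕ) : ℝ))) a, mul_comm (16 * ((d : ℝ) + 1) * ((d : ℝ) + 4) * (L : ℝ) ^ 2) a, nearIdC_smul, curlLetterC, mul_comm]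

omit [Fintype n] [DecidableEq n] in
/-- `0 ≤ nearIdC d L b ρ` for `b, ρ ≥ 0`. [folklore] -/
theorem nearIdC_nonneg (d L : ℕ) {b ρ : ℝ} (hb : 0 ≤ b) (hρ : 0 ≤ ρ) : 0 ≤ nearIdC d L b ρ := by
  unfold nearIdC; positivity

omit [Fintype n] [DecidableEq n] in
/-- `0 ≤ curlLetterC d L`. [folklore] -/
theorem curlLetterC_nonneg (d L : ℕ) : 0 ≤ curlLetterC d L := nearIdC_nonneg d L (by positivity) (by positivity)

/-- The `ℓ¹` norm is gauge invariant: `dirL1 (ψ^u) B = dirL1 ψ B` for unitary `u`. [folklore] -/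
theorem dirL1_dirGauge [Nonempty n] {u : Site d → (Matrix n n ℂ)ˣ} (hu : ∀ x, u x ∈ unitaryUnits (Matrix n n ℂ)) (ψ : Site d → Fin d → Matrix n n ℂ)
    (B : Finset (Site d)) : dirL1 (dirGauge u ψ) B = dirL1 ψ B := by
  unfold T4AveragingDeficitWall.dirL1 dirGauge
  exact Finset.sum_congr rfl fun x _ => Finset.sum_congr rfl fun κ _ => norm_Ad_of_unitary (hu _) _

/-- **BAŁABAN'S (48) AT A SMALL-FIELD BACKGROUND, WITH REMAINDER**: for every `U(N)` configuration `W` in the standard small-field class (`SmallField W a`,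
`512(d+1)(d+4)L²a ≤ 1`), every direction field `ψ`, every coarse plaquette `(z; μ, ν)`,
`‖curlAt (cavg L W) (cpush L W ψ) z μ ν − Σ_r L^{−d} • Σ_{i,j<L} Ad_{W(Γ_{Lz,p})} (curlAt W ψ p μ ν)‖ ≤ curlLetterC d L · a · dirL1 ψ (box ((2d+4)L) (L•z))`,
`p = L•z + x_r + i e_μ + j e_ν`, `W(Γ_{Lz,p}) = hol W (L•z) (treeWord (x_r + i e_μ + j e_ν))` (the transport from the block corner along the tree word).
[cite: Balaban1985Averaging, (48) p.25] -/
theorem norm_curlAt_cavg_cpush_sub_avgAd_le [Nonempty n] {L : ℕ} (hL : 1 ≤ L) {W : Site d → Fin d → (Matrix n n ℂ)ˣ} (hW : IsUnitaryCfg W)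
    {a : ℝ} (ha : 0 ≤ a) (h512 : 512 * (d + 1) * (d + 4) * (L : ℝ) ^ 2 * a ≤ 1) (hWa : SmallField W a)
    (ψ : Site d → Fin d → Matrix n n ℂ) (z : Site d) (μ ν : Fin d) :
    ‖curlAt (cavg L W) (cpush L W ψ) z μ ν
        - ∑ r : Fin d → Fin L, (((L : ℝ) ^ d)⁻¹ : ℝ) • ∑ i ∈ Finset.range L, ∑ j ∈ Finset.range L,
            Ad (hol W ((L : ℤ) • z) (treeWord (boxVec L r + (i : ℤ) • e μ + (j : ℤ) • e ν)))
              (curlAt W ψ ((L : ℤ) • z + boxVec L r + (i : ℤ) • e μ + (j : ℤ) • e ν) μ ν)‖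
      ≤ curlLetterC d L * a * dirL1 ψ (box ((2 * d + 4) * L) ((L : ℤ) • z)) := by
  set y : Site d := (L : ℤ) • z with hy
  -- the axial gauge based at `y`
  set u : Site d → (Matrix n n ℂ)ˣ := axialFn W y with hu
  have huu : ∀ x, u x ∈ unitaryUnits (Matrix n n ℂ) := fun x => hol_mem_of hW _ _
  set W' : Site d → Fin d → (Matrix n n ℂ)ˣ := gaugeAct u W with hW'
  set ψ' : Site d → Fin d → Matrix n n ℂ := dirGauge u ψ with hψ'
  have hW'u : IsUnitaryCfg W' := fun x κ =>
    (unitaryUnits (Matrix n n ℂ)).mul_mem ((unitaryUnits (Matrix n n ℂ)).mul_mem (huu x) (hW x κ)) ((unitaryUnits (Matrix n n ℂ)).inv_mem (huu _))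
  have hW'a : SmallField W' a := smallField_gaugeAct huu hWa
  have hU1 : ∀ x κ, W x κ ∈ U1 (Matrix n n ℂ) := fun x κ => mem_U1_of_unitary (hW x κ)
  have hlinks : ∀ (x : Site d) (μ' : Fin d), l1 (x - y) ≤ (2 * d + 4) * L →
      ‖((W' x μ' : (Matrix n n ℂ)ˣ) : Matrix n n ℂ) - 1‖ ≤ (((2 * d + 4) * L : ℕ) : ℝ) * a := by
    intro x μ' hx
    have h := axial_bond_bound W hU1 y (fun x κ κ' hne => hWa x κ κ' hne) ha x μ'
    refine h.trans (mul_le_mul_of_nonneg_right (by exact_mod_cast hx) ha)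
  -- §1 in the axial gauge
  have hmain := norm_curlAt_cavg_cpush_sub_avg_le_of_links hL hW'u ha h512 hW'a z (by positivity) hlinks ψ' μ ν
  rw [nearIdC_axial_eq, dirL1_dirGauge huu] at hmain
  -- covariance: the coarse side
  have hu_y : u y = 1 := by rw [hu]; unfold axialFn; rw [sub_self, treeWord_zero, hol_nil]
  have hcavg : cavg L W' = gaugeAct (fun w => u ((L : ℤ) • w)) (cavg L W) := cavg_gaugeAct hL hW ha h512 hWa huu
  have hcpush : cpush L W' ψ' = dirGauge (fun w => u ((L : ℤ) • w)) (cpush L W ψ) := by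
    rw [hψ']; unfold dirGauge
    rw [cpush_gaugeAct hL hW ha h512 hWa huu ψ]
  have hcoarse : curlAt (cavg L W') (cpush L W' ψ') z μ ν = curlAt (cavg L W) (cpush L W ψ) z μ ν := by
    rw [hcavg, hcpush, curlAt_gaugeAct, ← hy, hu_y, Ad_one]
  -- covariance: the fine plaquettes
  have hfine : ∀ (r : Fin d → Fin L) (i j : ℕ),
      curlAt W' ψ' (y + boxVec L r + (i : ℤ) • e μ + (j : ℤ) • e ν) μ ν
        = Ad (hol W y (treeWord (boxVec L r + (i : ℤ) • e μ + (j : ℤ) • e ν))) (curlAt W ψ (y + boxVec L r + (i : ℤ) • e μ + (j : ℤ) • e ν) μ ν) := by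
    intro r i j
    rw [hW', hψ', curlAt_gaugeAct, hu]
    unfold axialFn
    rw [show y + boxVec L r + (i : ℤ) • e μ + (j : ℤ) • e ν - y = boxVec L r + (i : ℤ) • e μ + (j : ℤ) • e ν by abel]
  rw [hcoarse] at hmain
  rw [← hy] at hmain
  simp only [hfine] at hmain
  exact hmain

end

end Summit.QuantumFields.BalabanUV.T4Continuum.NE7CurvedAverageCurlLetter
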